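import Summits.BirchSwinnertonDyer.Rank1Residual.Partition.EisensteinKernelDiscriminant
import HarnessLib

/-!
# The Greenberg–Vatsal parity of a rational `p`-line at ANY odd `p`, read off its real points:
# `Φ` is even iff its non-zero points are real iff `4x³ + b₂x² + 2b₄x + b₆ > 0` at their abscissa

HONEST FRAMING (cell `b2b-bsdres-*`, verbatim): the goal of the cell is to DELETE the
COMBINATION-SHAPED residual classes for ALL analytic-rank ≤ 1 curves over ℚ — "full BSD formula
for every rank ≤ 1 curve in class C" assembled STRICTLY from published theorems — so that the
rank-≤1 remainder becomes exactly the CONSTRUCTION-SHAPED classes, which are TYPED (missing-input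
Props), NOT attempted; this is not "finishing BSD". Off-peak literature typer `b2b-bsdres-lit-cgls`
(CGLS22 / GV00, the reducible = Eisenstein column), session 14: an ELEMENTARY REDUCTION of the
Eisenstein column at EVERY odd prime `p` — theorems only, no definition, no named fact, nothing
booked, no label changed.

WHY. The Greenberg–Vatsal hypothesis `GVPar W p` (Invent. Math. 142 (2000) Thm. 1.3: some rational
`p`-isogeny kernel `Φ` is "ramified at `p` and even, or unramified at `p` and odd") is decided by the
lane's engine of record `gv_condition` (bsdN/HYPOTHESES.md row T-GV0, also rows T-CGLS-F / X2):
"parity = sign pattern of `f = 4x³ + b₂x² + 2b₄x + b₆` on the roots of the kernel polynomial `H`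
(`p − 1` real kernel points ⇔ even, `0` ⇔ odd)". Sessions 11–13 made this THEORY-LEVEL at `p = 3`
(`KernelDisc.lineEven_three_iff_abscissa`: `LineEven W 3 Φ ↔ 0 < b₂ + 12x₀`). This file proves the
dictionary entry at every odd `p`, for every rational line, with no hypothesis on the reduction of
`E` (all [folklore]; Silverman *AEC* III.2.3, III.§1, VIII.§1):

* §1 under an embedding `ι : ℚ̄ → ℂ` realising `c ∈ Γ_ℚ` as complex conjugation
  (`isComplexConjugation_iff`), a `c`-fixed `w ≠ 0` has `ι(w²)` real `> 0` (`re_sq_pos_of_smul_eq`),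
  a `c`-negated `w ≠ 0` has `ι(w²)` real `< 0` (`re_sq_neg_of_smul_eq_neg`);
* §2 `smul_abscissa_eq` — **the abscissa of a non-zero point `P = (x, y)` of a rational `p`-line is
  fixed by complex conjugation** (`cP = ±P`, `lineEven_or_lineOdd`), i.e. `ι x ∈ ℝ`
  (`exists_abscissa_eq_ofReal`); `aeval_Ψ₂Sq_eq_sq` — `Ψ₂Sq(x) = (2y + a₁x + a₃)²`;
* §3 **`lineEven_iff_re_pos` / `lineOdd_iff_re_neg`** — `LineEven W p Φ ↔ 0 < Re ι(Ψ₂Sq(x))`,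
  `LineOdd W p Φ ↔ Re ι(Ψ₂Sq(x)) < 0`: `cP = P` fixes `w = 2y + a₁x + a₃` (the point is REAL),
  `cP = −P = (x, −y − a₁x − a₃)` negates `w` (purely imaginary ordinate), and `w ≠ 0` because `2P ≠ O`
  on a line of odd prime order; `lineEven_iff_smul_coords_eq` — even iff the non-zero points are REAL;
* §4 the REAL-ROOT form consumed by the engines: with `ι x = r ∈ ℝ`,
  **`lineEven_iff_aeval_real_pos : LineEven W p Φ ↔ 0 < Ψ₂Sq(r)`** (evaluation in `ℝ`),
  `lineOdd_iff_aeval_real_neg`, and the CERTIFICATE shape **`lineEven_of_forall_real_root_pos`** /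
  **`lineOdd_of_forall_real_root_neg`**: if `F ∈ ℚ[X]` vanishes at the abscissa of a non-zero point
  of `Φ` (e.g. the kernel polynomial; at `p = 3`, `F = Ψ₃` by `KernelDisc.eval_Ψ₃_eq_zero_of_mem`) and
  `Ψ₂Sq > 0` (resp. `< 0`) at every real root of `F`, then `Φ` is even (resp. odd) — T-GV0's
  "polsturm" step as a theorem; `aeval_real_pos_iff_of_mem` — no mixed signs on one line.

References: R. Greenberg, V. Vatsal, Invent. Math. 142 (2000), Thm. 1.3 [GreenbergVatsal2000];
J. H. Silverman, *AEC*, GTM 106 (2009), III.2.3 (negation formula), III.§1 (`b₂, b₄, b₆`), VIII.§1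
[SilvermanAEC2009]; bsdN/HYPOTHESES.md row T-GV0 (decision procedure of record);
HOME/b2b-bsdres-lit-cgls/CGLS-GV-TYPING.md §21.
-/

set_option autoImplicit false

noncomputable section

open scoped Classical NumberField ComplexConjugate

open WeierstrassCurve Polynomial Literature.NumberTheory.EllipticCurves
  Literature.NumberTheory.EllipticCurves.Rank1Residual Literature.NumberTheory.GaloisRepresentations
  Field

namespace Summit.BirchSwinnertonDyer.Rank1Residual

namespace KernelDisc

variable {W : WeierstrassCurve ℚ} {p : ℕ} [Fact p.Prime]

/-! ### §1. A complex conjugation, its embedding `ι : ℚ̄ → ℂ`, and signs of squares -/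

section Conj

variable {c : absoluteGaloisGroup ℚ} {ι : AlgebraicClosure ℚ →+* ℂ}

/-- An element fixed by the complex conjugation `c` is real under `ι`. [folklore] -/
theorem im_eq_zero_of_smul_eq (hι : ∀ z, ι (c • z) = conj (ι z)) {z : AlgebraicClosure ℚ}
    (h : c • z = z) : (ι z).im = 0 :=
  Complex.conj_eq_iff_im.mp (by rw [← hι, h])

/-- An element negated by the complex conjugation `c` is purely imaginary under `ι`. [folklore] -/
theorem re_eq_zero_of_smul_eq_neg (hι : ∀ z, ι (c • z) = conj (ι z)) {z : AlgebraicClosure ℚ}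
    (h : c • z = -z) : (ι z).re = 0 := by
  have h1 : conj (ι z) = -ι z := by rw [← hι, h, map_neg]
  have h2 := congrArg Complex.re h1
  rw [Complex.conj_re, Complex.neg_re] at h2
  linarith

/-- The square of a non-zero real number is a positive real: `c • w = w`, `w ≠ 0` ⇒
`Re ι(w²) > 0`, `Im ι(w²) = 0`. [folklore] -/
theorem re_sq_pos_of_smul_eq (hι : ∀ z, ι (c • z) = conj (ι z)) {w : AlgebraicClosure ℚ}
    (h : c • w = w) (hw : w ≠ 0) : 0 < (ι (w ^ 2)).re ∧ (ι (w ^ 2)).im = 0 := by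
  have him : (ι w).im = 0 := im_eq_zero_of_smul_eq hι h
  have hne : ι w ≠ 0 := (map_ne_zero ι).mpr hw
  have hre : (ι w).re ≠ 0 := fun h0 ↦ hne (Complex.ext (by simpa using h0) (by simpa using him))
  rw [map_pow, pow_two, Complex.mul_re, Complex.mul_im, him]
  refine ⟨?_, by ring⟩
  have : 0 < (ι w).re * (ι w).re := mul_self_pos.mpr hre
  linarith

/-- The square of a non-zero purely imaginary number is a negative real: `c • w = -w`, `w ≠ 0` ⇒
`Re ι(w²) < 0`, `Im ι(w²) = 0`. [folklore] -/
theorem re_sq_neg_of_smul_eq_neg (hι : ∀ z, ι (c • z) = conj (ι z)) {w : AlgebraicClosure ℚ}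
    (h : c • w = -w) (hw : w ≠ 0) : (ι (w ^ 2)).re < 0 ∧ (ι (w ^ 2)).im = 0 := by
  have hre : (ι w).re = 0 := re_eq_zero_of_smul_eq_neg hι h
  have hne : ι w ≠ 0 := (map_ne_zero ι).mpr hw
  have him : (ι w).im ≠ 0 := fun h0 ↦ hne (Complex.ext (by simpa using hre) (by simpa using h0))
  rw [map_pow, pow_two, Complex.mul_re, Complex.mul_im, hre]
  refine ⟨?_, by ring⟩
  have : 0 < (ι w).im * (ι w).im := mul_self_pos.mpr him
  linarith

/-- Transport of rational polynomials along `ι`: `ι(F(z)) = F(ι z)`, both evaluated through the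
unique maps `ℚ → ℚ̄`, `ℚ → ℂ`. [folklore] -/
theorem map_aeval_eq (ι : AlgebraicClosure ℚ →+* ℂ) (F : ℚ[X]) (z : AlgebraicClosure ℚ) :
    ι (aeval z F) = F.eval₂ (algebraMap ℚ ℂ) (ι z) := by
  rw [aeval_def, hom_eval₂, RingHom.ext_rat (ι.comp (algebraMap ℚ (AlgebraicClosure ℚ))) (algebraMap ℚ ℂ)]

/-- At a real argument a rational polynomial takes the real value computed in `ℝ`:
`F(r) ∈ ℂ` is `(F(r) : ℝ)`. [folklore] -/
theorem eval₂_ofReal_eq (F : ℚ[X]) (r : ℝ) :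
    F.eval₂ (algebraMap ℚ ℂ) (r : ℂ) = ((aeval r F : ℝ) : ℂ) := by
  rw [aeval_def, RingHom.ext_rat (algebraMap ℚ ℂ) (Complex.ofRealHom.comp (algebraMap ℚ ℝ)),
    ← eval₂_map, ← Complex.ofRealHom_eq_coe, eval₂_hom, eval_map]
  rfl

end Conj

/-! ### §2. The abscissa of a point of a rational line is real; `Ψ₂Sq(x) = (2y + a₁x + a₃)²` -/

/-- `Ψ₂Sq(x) = 4x³ + b₂x² + 2b₄x + b₆` at `x ∈ ℚ̄` (the `bᵢ` pushed into `ℚ̄`). [folklore] -/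
theorem aeval_Ψ₂Sq (x : AlgebraicClosure ℚ) :
    aeval x W.Ψ₂Sq = 4 * x ^ 3 + algebraMap ℚ (AlgebraicClosure ℚ) W.b₂ * x ^ 2 +
      2 * algebraMap ℚ (AlgebraicClosure ℚ) W.b₄ * x + algebraMap ℚ (AlgebraicClosure ℚ) W.b₆ := by
  simp only [Ψ₂Sq, map_add, map_mul, aeval_C, aeval_X, map_pow, map_ofNat]

/-- **`Ψ₂Sq(x) = (2y + a₁x + a₃)²` at a point `(x, y) ∈ E(ℚ̄)`** (Silverman *AEC* III.§1).
[folklore] -/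
theorem aeval_Ψ₂Sq_eq_sq {x y : AlgebraicClosure ℚ}
    (h : (W.baseChange (AlgebraicClosure ℚ)).toAffine.Nonsingular x y) :
    aeval x W.Ψ₂Sq = (2 * y + (W.baseChange (AlgebraicClosure ℚ)).a₁ * x +
      (W.baseChange (AlgebraicClosure ℚ)).a₃) ^ 2 := by
  rw [sq_eq_twoTorsionPolynomial (W.baseChange (AlgebraicClosure ℚ)) h.1, aeval_Ψ₂Sq]
  have hb₂ : algebraMap ℚ (AlgebraicClosure ℚ) W.b₂ = (W.baseChange (AlgebraicClosure ℚ)).b₂ :=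
    (W.map_b₂ _).symm
  have hb₄ : algebraMap ℚ (AlgebraicClosure ℚ) W.b₄ = (W.baseChange (AlgebraicClosure ℚ)).b₄ :=
    (W.map_b₄ _).symm
  have hb₆ : algebraMap ℚ (AlgebraicClosure ℚ) W.b₆ = (W.baseChange (AlgebraicClosure ℚ)).b₆ :=
    (W.map_b₆ _).symm
  rw [hb₂, hb₄, hb₆]

section Line

variable {Φ : AddSubgroup (geomTorsion W (p : ℤ))}

/-- The quantity `w = 2y + a₁x + a₃` of a point `P = (x, y)`: `c • w = w` if `cP = P`, and
`c • w = -w` if `cP = -P = (x, -y - a₁x - a₃)` (Silverman *AEC* III.2.3). [folklore] -/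
theorem smul_ordinateQuantity (σ : absoluteGaloisGroup ℚ) {P : W.geomPoints} {x y : AlgebraicClosure ℚ}
    {h : (W.baseChange (AlgebraicClosure ℚ)).toAffine.Nonsingular x y} (hP : P = Affine.Point.some x y h) :
    (σ • P = P → σ • (2 * y + (W.baseChange (AlgebraicClosure ℚ)).a₁ * x +
        (W.baseChange (AlgebraicClosure ℚ)).a₃) =
      2 * y + (W.baseChange (AlgebraicClosure ℚ)).a₁ * x + (W.baseChange (AlgebraicClosure ℚ)).a₃) ∧
    (σ • P = -P → σ • (2 * y + (W.baseChange (AlgebraicClosure ℚ)).a₁ * x +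
        (W.baseChange (AlgebraicClosure ℚ)).a₃) =
      -(2 * y + (W.baseChange (AlgebraicClosure ℚ)).a₁ * x + (W.baseChange (AlgebraicClosure ℚ)).a₃)) := by
  have hσA₁ : σ • (W.baseChange (AlgebraicClosure ℚ)).a₁ = (W.baseChange (AlgebraicClosure ℚ)).a₁ :=
    smul_algebraMap σ W.a₁
  have hσA₃ : σ • (W.baseChange (AlgebraicClosure ℚ)).a₃ = (W.baseChange (AlgebraicClosure ℚ)).a₃ :=
    smul_algebraMap σ W.a₃
  have hσ2 : σ • (2 : AlgebraicClosure ℚ) = 2 := by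
    rw [show (2 : AlgebraicClosure ℚ) = algebraMap ℚ (AlgebraicClosure ℚ) 2 by norm_num]
    exact smul_algebraMap σ 2
  constructor
  · intro hσ
    obtain ⟨hx, hy⟩ := ((smul_eq_iff σ hP).1).mp hσ
    simp only [smul_add, smul_mul', hx, hy, hσA₁, hσA₃, hσ2]
  · intro hσ
    obtain ⟨hx, hy⟩ := ((smul_eq_iff σ hP).2).mp hσ
    simp only [smul_add, smul_mul', hx, hy, hσA₁, hσA₃, hσ2]
    ring

/-- `2y + a₁x + a₃ ≠ 0` at a point `P = (x, y)` with `2P ≠ O` (else `P = -P`). [folklore] -/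
theorem ordinateQuantity_ne_zero {P : W.geomPoints} {x y : AlgebraicClosure ℚ}
    {h : (W.baseChange (AlgebraicClosure ℚ)).toAffine.Nonsingular x y} (hP : P = Affine.Point.some x y h)
    (h2 : (2 : ℕ) • P ≠ 0) :
    2 * y + (W.baseChange (AlgebraicClosure ℚ)).a₁ * x + (W.baseChange (AlgebraicClosure ℚ)).a₃ ≠ 0 := by
  intro h0
  apply h2
  have hnegP : (1 : absoluteGaloisGroup ℚ) • P = -P := by
    refine ((smul_eq_iff 1 hP).2).mpr ⟨one_smul _ _, ?_⟩
    rw [one_smul]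
    linear_combination h0
  rw [one_smul] at hnegP
  rw [two_nsmul]
  nth_rewrite 2 [hnegP]
  exact add_neg_cancel P

/-- **The abscissa of a non-zero point of a rational `p`-line is fixed by every involution acting by
`±1`** — in particular by every complex conjugation (`lineEven_or_lineOdd`). [folklore] -/
theorem smul_abscissa_eq (hΦ : IsRationalLine W p Φ) {P : geomTorsion W (p : ℤ)} (hPΦ : P ∈ Φ)
    {x y : AlgebraicClosure ℚ} {h : (W.baseChange (AlgebraicClosure ℚ)).toAffine.Nonsingular x y}
    (hP : (P : W.geomPoints) = Affine.Point.some x y h)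
    {c : absoluteGaloisGroup ℚ} (hc : IsComplexConjugation (Rat.castHom ℝ) c) : c • x = x := by
  rcases lineEven_or_lineOdd hΦ with he | ho
  · have h1 : c • (P : W.geomPoints) = P := by rw [← AddSubgroup.torsionBy.coe_smul, he c hc P hPΦ]
    exact (((smul_eq_iff c hP).1).mp h1).1
  · have h1 : c • (P : W.geomPoints) = -(P : W.geomPoints) := by
      rw [← AddSubgroup.torsionBy.coe_smul, ho c hc P hPΦ, AddSubgroup.coe_neg]
    exact (((smul_eq_iff c hP).2).mp h1).1

/-- Under the embedding of a complex conjugation the abscissa of a non-zero point of a rational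
`p`-line is a REAL number. [folklore] -/
theorem exists_abscissa_eq_ofReal (hΦ : IsRationalLine W p Φ) {P : geomTorsion W (p : ℤ)} (hPΦ : P ∈ Φ)
    {x y : AlgebraicClosure ℚ} {h : (W.baseChange (AlgebraicClosure ℚ)).toAffine.Nonsingular x y}
    (hP : (P : W.geomPoints) = Affine.Point.some x y h)
    {c : absoluteGaloisGroup ℚ} (hc : IsComplexConjugation (Rat.castHom ℝ) c)
    {ι : AlgebraicClosure ℚ →+* ℂ} (hι : ∀ z, ι (c • z) = conj (ι z)) : ∃ r : ℝ, ι x = r :=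
  Complex.conj_eq_iff_real.mp (by rw [← hι, smul_abscissa_eq hΦ hPΦ hP hc])

/-! ### §3. Parity of the line = sign of `Ψ₂Sq` at the (real) abscissa of a non-zero point -/

/-- **Even ⇒ `Ψ₂Sq(x)` is a positive real**: if `Φ` is even then `cP = P`, `c` fixes
`w = 2y + a₁x + a₃ ≠ 0`, and `ι(Ψ₂Sq(x)) = ι(w)² > 0`. [folklore] -/
theorem re_pos_of_lineEven (hΦ : IsRationalLine W p Φ) (hp2 : p ≠ 2) {P : geomTorsion W (p : ℤ)}
    (hPΦ : P ∈ Φ) (hP0 : P ≠ 0)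
    {x y : AlgebraicClosure ℚ} {h : (W.baseChange (AlgebraicClosure ℚ)).toAffine.Nonsingular x y}
    (hP : (P : W.geomPoints) = Affine.Point.some x y h)
    {c : absoluteGaloisGroup ℚ} (hc : IsComplexConjugation (Rat.castHom ℝ) c)
    {ι : AlgebraicClosure ℚ →+* ℂ} (hι : ∀ z, ι (c • z) = conj (ι z)) (he : LineEven W p Φ) :
    0 < (ι (aeval x W.Ψ₂Sq)).re ∧ (ι (aeval x W.Ψ₂Sq)).im = 0 := by
  have h1 : c • (P : W.geomPoints) = P := by rw [← AddSubgroup.torsionBy.coe_smul, he c hc P hPΦ]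
  have hw := (smul_ordinateQuantity c hP).1 h1
  have hw0 := ordinateQuantity_ne_zero hP (two_smul_coe_ne_zero hΦ hp2 hPΦ hP0)
  rw [aeval_Ψ₂Sq_eq_sq h]
  exact re_sq_pos_of_smul_eq hι hw hw0

/-- **Odd ⇒ `Ψ₂Sq(x)` is a negative real**: if `Φ` is odd then `cP = -P = (x, -y - a₁x - a₃)`,
`c` negates `w = 2y + a₁x + a₃ ≠ 0`, and `ι(Ψ₂Sq(x)) = ι(w)² < 0`. [folklore] -/
theorem re_neg_of_lineOdd (hΦ : IsRationalLine W p Φ) (hp2 : p ≠ 2) {P : geomTorsion W (p : ℤ)}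
    (hPΦ : P ∈ Φ) (hP0 : P ≠ 0)
    {x y : AlgebraicClosure ℚ} {h : (W.baseChange (AlgebraicClosure ℚ)).toAffine.Nonsingular x y}
    (hP : (P : W.geomPoints) = Affine.Point.some x y h)
    {c : absoluteGaloisGroup ℚ} (hc : IsComplexConjugation (Rat.castHom ℝ) c)
    {ι : AlgebraicClosure ℚ →+* ℂ} (hι : ∀ z, ι (c • z) = conj (ι z)) (ho : LineOdd W p Φ) :
    (ι (aeval x W.Ψ₂Sq)).re < 0 ∧ (ι (aeval x W.Ψ₂Sq)).im = 0 := by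
  have h1 : c • (P : W.geomPoints) = -(P : W.geomPoints) := by
    rw [← AddSubgroup.torsionBy.coe_smul, ho c hc P hPΦ, AddSubgroup.coe_neg]
  have hw := (smul_ordinateQuantity c hP).2 h1
  have hw0 := ordinateQuantity_ne_zero hP (two_smul_coe_ne_zero hΦ hp2 hPΦ hP0)
  rw [aeval_Ψ₂Sq_eq_sq h]
  exact re_sq_neg_of_smul_eq_neg hι hw hw0

/-- `Ψ₂Sq(x)` is REAL under `ι` for the abscissa `x` of any non-zero point of a rational `p`-line,
`p` odd. [folklore] -/
theorem im_aeval_Ψ₂Sq_eq_zero (hΦ : IsRationalLine W p Φ) (hp2 : p ≠ 2) {P : geomTorsion W (p : ℤ)}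
    (hPΦ : P ∈ Φ) (hP0 : P ≠ 0)
    {x y : AlgebraicClosure ℚ} {h : (W.baseChange (AlgebraicClosure ℚ)).toAffine.Nonsingular x y}
    (hP : (P : W.geomPoints) = Affine.Point.some x y h)
    {c : absoluteGaloisGroup ℚ} (hc : IsComplexConjugation (Rat.castHom ℝ) c)
    {ι : AlgebraicClosure ℚ →+* ℂ} (hι : ∀ z, ι (c • z) = conj (ι z)) :
    (ι (aeval x W.Ψ₂Sq)).im = 0 := by
  rcases lineEven_or_lineOdd hΦ with he | ho
  · exact (re_pos_of_lineEven hΦ hp2 hPΦ hP0 hP hc hι he).2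
  · exact (re_neg_of_lineOdd hΦ hp2 hPΦ hP0 hP hc hι ho).2

/-- **Parity from the sign of `Ψ₂Sq` (even).** For a rational `p`-line `Φ` (`p` odd), a non-zero
point `P = (x, y) ∈ Φ`, and the embedding `ι : ℚ̄ → ℂ` of a complex conjugation `c`:
`Φ` is EVEN iff `ι(4x³ + b₂x² + 2b₄x + b₆)` is a POSITIVE real. [folklore] -/
theorem lineEven_iff_re_pos (hΦ : IsRationalLine W p Φ) (hp2 : p ≠ 2) {P : geomTorsion W (p : ℤ)}
    (hPΦ : P ∈ Φ) (hP0 : P ≠ 0)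
    {x y : AlgebraicClosure ℚ} {h : (W.baseChange (AlgebraicClosure ℚ)).toAffine.Nonsingular x y}
    (hP : (P : W.geomPoints) = Affine.Point.some x y h)
    {c : absoluteGaloisGroup ℚ} (hc : IsComplexConjugation (Rat.castHom ℝ) c)
    {ι : AlgebraicClosure ℚ →+* ℂ} (hι : ∀ z, ι (c • z) = conj (ι z)) :
    LineEven W p Φ ↔ 0 < (ι (aeval x W.Ψ₂Sq)).re := by
  refine ⟨fun he ↦ (re_pos_of_lineEven hΦ hp2 hPΦ hP0 hP hc hι he).1, fun hpos ↦ ?_⟩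
  rcases lineEven_or_lineOdd hΦ with he | ho
  · exact he
  · exact absurd hpos (not_lt.mpr (re_neg_of_lineOdd hΦ hp2 hPΦ hP0 hP hc hι ho).1.le)

/-- **Parity from the sign of `Ψ₂Sq` (odd).** Same data: `Φ` is ODD iff `ι(4x³ + b₂x² + 2b₄x + b₆)`
is a NEGATIVE real. [folklore] -/
theorem lineOdd_iff_re_neg (hΦ : IsRationalLine W p Φ) (hp2 : p ≠ 2) {P : geomTorsion W (p : ℤ)}
    (hPΦ : P ∈ Φ) (hP0 : P ≠ 0)
    {x y : AlgebraicClosure ℚ} {h : (W.baseChange (AlgebraicClosure ℚ)).toAffine.Nonsingular x y}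
    (hP : (P : W.geomPoints) = Affine.Point.some x y h)
    {c : absoluteGaloisGroup ℚ} (hc : IsComplexConjugation (Rat.castHom ℝ) c)
    {ι : AlgebraicClosure ℚ →+* ℂ} (hι : ∀ z, ι (c • z) = conj (ι z)) :
    LineOdd W p Φ ↔ (ι (aeval x W.Ψ₂Sq)).re < 0 := by
  refine ⟨fun ho ↦ (re_neg_of_lineOdd hΦ hp2 hPΦ hP0 hP hc hι ho).1, fun hneg ↦ ?_⟩
  rcases lineEven_or_lineOdd hΦ with he | ho
  · exact absurd hneg (not_lt.mpr (re_pos_of_lineEven hΦ hp2 hPΦ hP0 hP hc hι he).1.le)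
  · exact ho

/-- **Even iff the non-zero points are real**: `Φ` is even iff a complex conjugation fixes BOTH
coordinates of one (equivalently every) non-zero point of `Φ` — the "`p − 1` real kernel points"
reading of T-GV0. [folklore] -/
theorem lineEven_iff_smul_coords_eq (hΦ : IsRationalLine W p Φ) (hp2 : p ≠ 2) {P : geomTorsion W (p : ℤ)}
    (hPΦ : P ∈ Φ) (hP0 : P ≠ 0)
    {x y : AlgebraicClosure ℚ} {h : (W.baseChange (AlgebraicClosure ℚ)).toAffine.Nonsingular x y}
    (hP : (P : W.geomPoints) = Affine.Point.some x y h)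
    {c : absoluteGaloisGroup ℚ} (hc : IsComplexConjugation (Rat.castHom ℝ) c) :
    LineEven W p Φ ↔ c • x = x ∧ c • y = y := by
  constructor
  · intro he
    have h1 : c • (P : W.geomPoints) = P := by rw [← AddSubgroup.torsionBy.coe_smul, he c hc P hPΦ]
    exact ((smul_eq_iff c hP).1).mp h1
  · rintro hxy
    have h1 : c • (P : W.geomPoints) = P := ((smul_eq_iff c hP).1).mpr hxy
    rcases lineEven_or_lineOdd hΦ with he | ho
    · exact he
    · exfalso
      have h2 : c • (P : W.geomPoints) = -(P : W.geomPoints) := by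
        rw [← AddSubgroup.torsionBy.coe_smul, ho c hc P hPΦ, AddSubgroup.coe_neg]
      apply two_smul_coe_ne_zero hΦ hp2 hPΦ hP0
      rw [two_nsmul]
      nth_rewrite 2 [← h1]
      rw [h2]
      exact add_neg_cancel _

/-! ### §4. The real-root form (the engines' reading) and the certificate shape -/

/-- **`LineEven ↔ Ψ₂Sq(r) > 0` in `ℝ`**, where `r ∈ ℝ` is the embedded abscissa `ι x = r` of a
non-zero point of `Φ` (`exists_abscissa_eq_ofReal`). [folklore] -/
theorem lineEven_iff_aeval_real_pos (hΦ : IsRationalLine W p Φ) (hp2 : p ≠ 2) {P : geomTorsion W (p : ℤ)}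
    (hPΦ : P ∈ Φ) (hP0 : P ≠ 0)
    {x y : AlgebraicClosure ℚ} {h : (W.baseChange (AlgebraicClosure ℚ)).toAffine.Nonsingular x y}
    (hP : (P : W.geomPoints) = Affine.Point.some x y h)
    {c : absoluteGaloisGroup ℚ} (hc : IsComplexConjugation (Rat.castHom ℝ) c)
    {ι : AlgebraicClosure ℚ →+* ℂ} (hι : ∀ z, ι (c • z) = conj (ι z)) {r : ℝ} (hr : ι x = r) :
    LineEven W p Φ ↔ 0 < aeval r W.Ψ₂Sq := by
  rw [lineEven_iff_re_pos hΦ hp2 hPΦ hP0 hP hc hι, map_aeval_eq, hr, eval₂_ofReal_eq,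
    Complex.ofReal_re]

/-- **`LineOdd ↔ Ψ₂Sq(r) < 0` in `ℝ`**, `ι x = r`. [folklore] -/
theorem lineOdd_iff_aeval_real_neg (hΦ : IsRationalLine W p Φ) (hp2 : p ≠ 2) {P : geomTorsion W (p : ℤ)}
    (hPΦ : P ∈ Φ) (hP0 : P ≠ 0)
    {x y : AlgebraicClosure ℚ} {h : (W.baseChange (AlgebraicClosure ℚ)).toAffine.Nonsingular x y}
    (hP : (P : W.geomPoints) = Affine.Point.some x y h)
    {c : absoluteGaloisGroup ℚ} (hc : IsComplexConjugation (Rat.castHom ℝ) c)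
    {ι : AlgebraicClosure ℚ →+* ℂ} (hι : ∀ z, ι (c • z) = conj (ι z)) {r : ℝ} (hr : ι x = r) :
    LineOdd W p Φ ↔ aeval r W.Ψ₂Sq < 0 := by
  rw [lineOdd_iff_re_neg hΦ hp2 hPΦ hP0 hP hc hι, map_aeval_eq, hr, eval₂_ofReal_eq,
    Complex.ofReal_re]

/-- The embedded abscissa `r` is a real root of every rational polynomial vanishing at `x`.
[folklore] -/
theorem aeval_real_eq_zero_of_aeval_eq_zero {ι : AlgebraicClosure ℚ →+* ℂ} {x : AlgebraicClosure ℚ}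
    {r : ℝ} (hr : ι x = r) {F : ℚ[X]} (hF : aeval x F = 0) : aeval r F = 0 := by
  have h1 : ι (aeval x F) = 0 := by rw [hF, map_zero]
  rw [map_aeval_eq, hr, eval₂_ofReal_eq, Complex.ofReal_eq_zero] at h1
  exact h1

/-- **Certificate shape (even) — T-GV0's "sign of `f` on the real roots of the kernel polynomial"
as a theorem.** Let `Φ` be a rational `p`-line (`p` odd), `P = (x, y) ∈ Φ` non-zero, and
`F ∈ ℚ[X]` with `F(x) = 0` (e.g. the kernel polynomial of `Φ`; at `p = 3`, `F = Ψ₃`). If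
`4r³ + b₂r² + 2b₄r + b₆ > 0` at EVERY real root `r` of `F`, then `Φ` is EVEN. [folklore] -/
theorem lineEven_of_forall_real_root_pos (hΦ : IsRationalLine W p Φ) (hp2 : p ≠ 2)
    {P : geomTorsion W (p : ℤ)} (hPΦ : P ∈ Φ) (hP0 : P ≠ 0)
    {x y : AlgebraicClosure ℚ} {h : (W.baseChange (AlgebraicClosure ℚ)).toAffine.Nonsingular x y}
    (hP : (P : W.geomPoints) = Affine.Point.some x y h) {F : ℚ[X]} (hF : aeval x F = 0)
    (hpos : ∀ r : ℝ, aeval r F = 0 → 0 < aeval r W.Ψ₂Sq) : LineEven W p Φ := by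
  obtain ⟨c, hc⟩ := exists_isComplexConjugation (Rat.castHom ℝ)
  obtain ⟨ι, -, hι⟩ := isComplexConjugation_iff.mp hc
  obtain ⟨r, hr⟩ := exists_abscissa_eq_ofReal hΦ hPΦ hP hc hι
  exact (lineEven_iff_aeval_real_pos hΦ hp2 hPΦ hP0 hP hc hι hr).mpr
    (hpos r (aeval_real_eq_zero_of_aeval_eq_zero hr hF))

/-- **Certificate shape (odd).** Same data; if `4r³ + b₂r² + 2b₄r + b₆ < 0` at every real root `r`
of `F`, then `Φ` is ODD. [folklore] -/
theorem lineOdd_of_forall_real_root_neg (hΦ : IsRationalLine W p Φ) (hp2 : p ≠ 2)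
    {P : geomTorsion W (p : ℤ)} (hPΦ : P ∈ Φ) (hP0 : P ≠ 0)
    {x y : AlgebraicClosure ℚ} {h : (W.baseChange (AlgebraicClosure ℚ)).toAffine.Nonsingular x y}
    (hP : (P : W.geomPoints) = Affine.Point.some x y h) {F : ℚ[X]} (hF : aeval x F = 0)
    (hneg : ∀ r : ℝ, aeval r F = 0 → aeval r W.Ψ₂Sq < 0) : LineOdd W p Φ := by
  obtain ⟨c, hc⟩ := exists_isComplexConjugation (Rat.castHom ℝ)
  obtain ⟨ι, -, hι⟩ := isComplexConjugation_iff.mp hc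
  obtain ⟨r, hr⟩ := exists_abscissa_eq_ofReal hΦ hPΦ hP hc hι
  exact (lineOdd_iff_aeval_real_neg hΦ hp2 hPΦ hP0 hP hc hι hr).mpr
    (hneg r (aeval_real_eq_zero_of_aeval_eq_zero hr hF))

/-- **Mixed signs are impossible**: if `F ∈ ℚ[X]` vanishes at the abscissas of two non-zero points of
the SAME rational `p`-line, the sign of `Ψ₂Sq` at the two embedded real abscissas is the same
(both read the parity of `Φ`) — T-GV0's "mixed ⇒ not a rational line" check. [folklore] -/
theorem aeval_real_pos_iff_of_mem (hΦ : IsRationalLine W p Φ) (hp2 : p ≠ 2)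
    {P P' : geomTorsion W (p : ℤ)} (hPΦ : P ∈ Φ) (hP0 : P ≠ 0) (hP'Φ : P' ∈ Φ) (hP'0 : P' ≠ 0)
    {x y x' y' : AlgebraicClosure ℚ} {h : (W.baseChange (AlgebraicClosure ℚ)).toAffine.Nonsingular x y}
    {h' : (W.baseChange (AlgebraicClosure ℚ)).toAffine.Nonsingular x' y'}
    (hP : (P : W.geomPoints) = Affine.Point.some x y h) (hP' : (P' : W.geomPoints) = Affine.Point.some x' y' h')
    {c : absoluteGaloisGroup ℚ} (hc : IsComplexConjugation (Rat.castHom ℝ) c)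
    {ι : AlgebraicClosure ℚ →+* ℂ} (hι : ∀ z, ι (c • z) = conj (ι z)) {r r' : ℝ} (hr : ι x = r)
    (hr' : ι x' = r') : 0 < aeval r W.Ψ₂Sq ↔ 0 < aeval r' W.Ψ₂Sq := by
  rw [← lineEven_iff_aeval_real_pos hΦ hp2 hPΦ hP0 hP hc hι hr,
    ← lineEven_iff_aeval_real_pos hΦ hp2 hP'Φ hP'0 hP' hc hι hr']

end Line

end KernelDisc

end Summit.BirchSwinnertonDyer.Rank1Residual

end
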